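import Summits.BirchSwinnertonDyer.BirchSwinnertonDyer.Theorems.SemiOrdinaryEisensteinDescentWildSigmaDivisibilityAtThreeTowerFreeOfFlatOfManinScaling
import Summits.BirchSwinnertonDyer.BirchSwinnertonDyer.Theorems.Rank1ResidualJetModPCarrierEndFormsNoCV
import Summits.BirchSwinnertonDyer.BirchSwinnertonDyer.Theorems.Rank1ResidualJetModPSwapLevelRaisingLiterature
import Summits.BirchSwinnertonDyer.Rank1Residual.JET.CarrierEndFormsGross1991
import Summits.BirchSwinnertonDyer.Rank1Residual.X11b.KolyvaginBottomPoint
import Literature.NumberTheory.EllipticCurves.HeegnerPointsOfConductorOneData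
import Literature.NumberTheory.EllipticCurves.HeegnerPointsOfConductorOneGaloisConjProofs
import Literature.NumberTheory.EllipticCurves.HeegnerPointsOfConductorOneRationalityProofs
import Literature.NumberTheory.EllipticCurves.ZywinaCMImageProofs
import HarnessLib

/-!
# Route `SemiOrdinaryEisensteinDescent`, crux of record Ko′ `WildKolyvaginUpperAtThreeTowerFree` (stmt-BirchSwinnertonDyer-24696):
# Jetchev's max-form at `3 ∣ N` under `ρ̄₃` onto ONLY (the displayed `hJmax` of p598295 §2 PROVED from {PT, F1, 3.7(2)}), and
# Ko′ BY NAME ⟸ {CT, 3.7 (2), E0, PT} + ManinScaling₃ + J′♭ on frames with ≥ 2 TAMAGAWA `3`-carriers — NO tower anywhere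
# (width seat `bsd-wall-soed-p2-w2` g5; `--supports stmt-…-24696`, helper)

WHY. The single-carrier sub-cell of Ko′ (Jetchev 2008 Thm. 1.4 at the bad prime `3`) was closed by
`SchneiderFree.Exact.jetchevMaxAtThree_of_literature` only ON the `3`-adic tower, because the `bsd-jet` road-K end forms
carried the tower as a binder; the series `Rank1ResidualJetModP*` (this seat, parts 1–15) re-issued their whole cone under
`ρ̄_p` onto only (every leaf use was `htower 1`; McCallum 1991 §3 and Cha 2005 Thm. 3/7 need only the mod-`p` image). This
file reads the result back into the SOED column (imports chosen OFF the UniversalToricDescent cone):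
* `jetchevMaxModThree_of_literature` — the displayed `hJmax` of `…TowerFreePrintClosedSubcells` §2 (p598295) VERBATIM as a
  theorem ⟸ (PT) `poitouTate_selmerStructure_duality_conj` (∀ `K`), (F1) = E0 `Gross1991_heegnerPoint_sub_ratTorsion_mem_E0`,
  (3.7) `GrossLMS1991.prop37_2_frobeniusCongruence`: Jetchev's max-form divisibility at `3 ∣ N` for EVERY onto-mod-`3` curve of
  the cell (tower or not — Elkies' index-27 family included), via the mod-`p` end forms of parts 9/14 (combined form: `JET.jetchevDivisibility_modP_of_swapLiterature`, part 15). (The pen's act G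
  files this text as `JetchevMaxDivisibilityAtThreeModThree`.)
* `sigmaFlat_of_threePrintFacts_of_flatMultiCarrier` — J′♭ (all frames) ⟸ Jetchev max (mod `3`) + J′♭ on multi-Tamagawa-carrier
  frames (= `…TowerFreeResidueOfManinScaling` §1, restated here so that this file does not wait on that module).
* `wildKolyvaginUpperAtThreeTowerFree_of_flatMultiCarrier_of_maninScaling_of_fourPrimitives` — **Ko′ BY NAME ⟸ {CT, 3.7(2), E0, PT}
  + ManinScaling₃ + J′♭ on frames with ≥ 2 TAMAGAWA `3`-carriers** (`hJmF`); the off-tower term of the residue is GONE: the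
  research input of the SOED Ko′-column is exactly census T17's JET-PRODUCT residue (Büyükboduk 2009 §4.2 Question 1 at `3`) ⊕ Manin₃.
* `wildSigmaDivisibilityAtThreeTowerFree_of_flatMultiCarrier_of_maninScaling_of_threePrintFacts` — J′ BY NAME from the same.
HONEST FRAMING: CONDITIONAL on the four named facts (Literature `def … : Prop`, hypotheses), on ManinScaling₃ (`3`-part of
Manin's conjecture at `27 ∣ N`, off print) and on `hJmF` (open research). Nothing about any curve is asserted; no definition, no
named fact, no `sorry`; Ko′, J′ and BSD stay open — BSD is not proved by this file.

References: [Jetchev2008] Thm. 1.4, Conj. 1.3 (p. 812); [McCallumLMS1991] §3, §5 Cor. 5.6 (p. 310); [Cha2005] Thm. 3,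
Thm. 7; [Elkies2006]; [Buyukboduk2009TamagawaDefect] §4.2 Question 1; [GrossLMS1991] Prop. 3.7 (2), §6; [MilneADT2006]
I Thm. 4.10; [CesnaviciusNeururerSaha2023] Thm. 1.2; [Zywina2015] Prop. 1.14.
-/

set_option autoImplicit false
set_option linter.dupNamespace false -- `Summit.BirchSwinnertonDyer.BirchSwinnertonDyer.…` is the tree's layout (D-0017)

noncomputable section

open scoped Classical

namespace Summit.BirchSwinnertonDyer.BirchSwinnertonDyer.Theorems.WildKolyvaginUpperAtThreeTowerFreeJetchevMaxModThree

open WeierstrassCurve NumberField IsDedekindDomain Field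
  Literature.NumberTheory.EllipticCurves
  Literature.NumberTheory.EllipticCurves.ModularForms
  Literature.NumberTheory.EllipticCurves.Rank1Residual
  Literature.NumberTheory.GaloisCohomology
  Summit.BirchSwinnertonDyer.Rank1Residual
  Summit.BirchSwinnertonDyer.Rank1Residual.Additive
  Summit.BirchSwinnertonDyer.Rank1Residual.X11b
  Summit.BirchSwinnertonDyer.Rank1Residual.X11b.Three
  Summit.BirchSwinnertonDyer.BirchSwinnertonDyer.Theses.SemiOrdinaryEisensteinDescent
  Summit.BirchSwinnertonDyer.BirchSwinnertonDyer.Theorems.WildSigmaDivisibilityAtThreeTowerFreeOfFlatOfManinScaling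
open Literature.NumberTheory.EllipticCurves.GrossLMS1991 (prop37_2_frobeniusCongruence)

/-! ## §1 Jetchev's max-form at `3 ∣ N` under `ρ̄₃` onto ONLY -/

/-- **RUNG J_max@3 WITHOUT the `3`-adic tower.** Under the binders of J′ `WildSigmaDivisibilityAtThreeTowerFree`
(`ClassO6 W 3`, `ρ̄₃` onto, `r_an = 1`, `N = N_E`, `K` imaginary quadratic Heegner for `N`, `L(E^{d_K},1) ≠ 0`, `P = y_K` of
the datum `(Dt, H, ι)` of infinite order, `d_K` odd, `d_K ≠ −3` — and NO tower), for EVERY prime `q ∣ N` and every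
`s′ ≤ ord₃ c_q(E)`, every derived Heegner point of a Kolyvagin–Heegner datum on the frame is `3^{s′}`-divisible — the
displayed hypothesis `hJmax` of `…TowerFreePrintClosedSubcells` §2 / `…TowerFreeResidueOfManinScaling` VERBATIM — GIVEN
(PT) `poitouTate_selmerStructure_duality_conj` (∀ `K`), (F1) `Gross1991_heegnerPoint_sub_ratTorsion_mem_E0`, (3.7)
`GrossLMS1991.prop37_2_frobeniusCongruence`. Proof = `SchneiderFree.Exact.jetchevMaxAtThree_of_literature` with the
road-K end forms replaced by their mod-`p` twins (`JET.Swap.levelRaising_of_literature_modP`, `JET.jetchevDivisibilityCarrier{Add,Ne}_of_levelRaisingNoCV_modP`; the combined form is `JET.jetchevDivisibility_modP_of_swapLiterature`); non-CM from `ρ̄₃` onto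
(Zywina/Serre, `not_hasSurjectiveModNGaloisRep_of_hasCM`). [cite: Jetchev2008, Thm. 1.4 (p. 812), Prop. 4.9, Thm. 6.3]
[cite: Cha2005, Thm. 3 and Thm. 7] [cite: GrossLMS1991, Prop. 3.7 (2) and Prop. 6.2 (1)] [cite: McCallumLMS1991, §3, Prop. 4.4] -/
theorem jetchevMaxModThree_of_literature
    (hPT : ∀ (K : Type) [Field K] [NumberField K], poitouTate_selmerStructure_duality_conj K)
    (hF1 : Gross1991_heegnerPoint_sub_ratTorsion_mem_E0) (h372 : prop37_2_frobeniusCongruence) :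
    ∀ (W : WeierstrassCurve ℚ) [W.IsElliptic] [W.IsGloballyMinimal] (N : ℕ) [NeZero N] (K : Type)
      [Field K] [NumberField K] (Dt : ModularParametrizationData W N)
      (H : HeegnerDatum N (NumberField.discr K)) (ι : K →+* ℂ) (P : (W.baseChange K).toAffine.Point),
      ClassO6 W 3 → W.HasSurjectiveModNGaloisRep 3 → W.analyticRank = 1 → W.conductorNorm ℤ = N →
      IsImaginaryQuadratic K → SatisfiesHeegnerHypothesis N K →
      (W.quadraticTwist (NumberField.discr K : ℚ)).entireLFunction 1 ≠ 0 →
      WeierstrassCurve.Affine.Point.map ι.toRatAlgHom P = heegnerPointComplex Dt H →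
      ¬ IsOfFinAddOrder P → Odd (NumberField.discr K) → NumberField.discr K ≠ -3 →
      ∀ (q : ℕ) [Fact q.Prime], q ∣ N →
      ∀ (s' : ℕ), s' ≤ padicValNat 3 ((W.baseChange ℚ_[q]).localTamagawaNumber ℤ_[q]) →
        ∀ (n : ℕ) (d : KolyvaginHeegnerData Dt H.β ι n), Squarefree n →
          (∀ ℓ ∈ n.primeFactors, Zhang2014.IsKolyvaginPrime N W K 3 ℓ ∧
            s' ≤ Zhang2014.kolyvaginIndex W 3 ℓ) → Koly.PDiv d 3 s' := by
  intro W _ _ N _ K _ _ Dt H ι P hO6 hsurj _hr hN hK hHH _hLd hP hnt hodd h3 q _ hqN s' hs' n d hn hℓ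
  subst hN
  haveI : Fact (Nat.Prime 3) := ⟨Nat.prime_three⟩
  -- `d_K ≠ -4` (odd), non-CM from `ρ̄₃` onto, additive at `3`
  have h4 : NumberField.discr K ≠ -4 := by
    intro h
    rw [h] at hodd
    exact (Int.not_odd_iff_even.mpr ⟨-2, by norm_num⟩) hodd
  have hcm : ¬ W.HasCM := fun hCM ↦
    W.not_hasSurjectiveModNGaloisRep_of_hasCM hCM Nat.prime_three (by decide) (by simpa using hsurj)
  have hbad : ¬ W.HasGoodReductionAtPrime 3 := not_good_of_addv W 3 hO6.2.1
  -- the conductor-`1` Kolyvagin–Heegner datum on the frame, with bottom point `P` (non-torsion)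
  obtain ⟨d₁⟩ := exists_kolyvaginHeegnerData_one
    (phi_heegnerTau_mem_singularModuliField_holds (W.conductorNorm ℤ) W K) hK Dt H.β ι H.dvd_sq_sub
  have hPd : d₁.toGeomPoints d₁.derivedPoint = toGeomPoints (W.baseChange K) P :=
    KolyvaginBottom.toGeomPoints_derivedPoint_one_eq
      (heegnerPointOfConductor_one_galoisConj_holds (W.conductorNorm ℤ) W K) hK hHH hP d₁ rfl
  have hy₁ : ¬ IsOfFinAddOrder d₁.derivedPoint := by
    intro hfo
    apply hnt
    have h1 : IsOfFinAddOrder (d₁.toGeomPoints d₁.derivedPoint) := d₁.toGeomPoints.isOfFinAddOrder hfo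
    rw [hPd] at h1
    exact (toGeomPoints_injective (W.baseChange K)).isOfFinAddOrder_iff.mp h1
  -- Jetchev Thm. 1.4 at the bad prime `3`, carrier `q`, mod-`3` image only: level raising (the swap walk) from the three
  -- named statements, then the additive end form at `q = 3` and the `q ≠ p` end form otherwise (`W` is additive at `3`)
  have hR := JET.Swap.levelRaising_of_literature_modP hPT hF1 h372
  have hGZ := JET.forall_hGZ_of_Gross1991 hF1
  by_cases hq3 : q = 3
  · subst hq3
    exact JET.jetchevDivisibilityCarrierAdd_of_levelRaisingNoCV_modP hR h372 hPT hGZ W hcm K hK h3 h4 hHH 3 (by decide)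
      hbad hO6.2.1.2 hsurj Dt H.β ι d₁ hy₁ s' hs' n d hn hℓ
  · exact JET.jetchevDivisibilityCarrierNe_of_levelRaisingNoCV_modP hR h372 hPT hGZ W hcm K hK h3 h4 hHH 3 (by decide)
      hsurj Dt H.β ι d₁ hy₁ q hqN hq3 s' hs' n d hn hℓ

/-! ## §2 J′♭ from Jetchev's max-form (mod `3`) and J′♭ on multi-Tamagawa-carrier frames -/

/-- **J′♭ on ALL frames ⟸ (PT), (F1), (3.7) + J′♭ on MULTI-TAMAGAWA-CARRIER frames** (`hJmF`: J′'s text + `¬ 3 ∣ Dt.c` +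
«no single prime `q ∣ N` carries the depth»). On a flat frame the depth is `T = ord₃ ∏ c_q`; if one `q₀ ∣ N` has
`ord₃ c_{q₀} ≥ T`, §1 at `q₀` gives it; otherwise `hJmF` does. (= `…TowerFreeResidueOfManinScaling` §1 with `hJmax`
discharged.) CONDITIONAL on the three named facts and `hJmF`. [cite: Jetchev2008, Thm. 1.4 and Conj. 1.3 (p. 812)]
[cite: Buyukboduk2009TamagawaDefect, §4.2 Question 1] -/
theorem sigmaFlat_of_threePrintFacts_of_flatMultiCarrier
    (hPT : ∀ (K : Type) [Field K] [NumberField K], poitouTate_selmerStructure_duality_conj K)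
    (hF1 : Gross1991_heegnerPoint_sub_ratTorsion_mem_E0) (h372 : prop37_2_frobeniusCongruence)
    (hJmF : ∀ (W : WeierstrassCurve ℚ) [W.IsElliptic] [W.IsGloballyMinimal] (N : ℕ) [NeZero N] (K : Type)
      [Field K] [NumberField K] (Dt : ModularParametrizationData W N)
      (H : HeegnerDatum N (NumberField.discr K)) (ι : K →+* ℂ) (P : (W.baseChange K).toAffine.Point),
      ClassO6 W 3 → W.HasSurjectiveModNGaloisRep 3 → W.analyticRank = 1 → W.conductorNorm ℤ = N →
      IsImaginaryQuadratic K → SatisfiesHeegnerHypothesis N K →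
      (W.quadraticTwist (NumberField.discr K : ℚ)).entireLFunction 1 ≠ 0 →
      WeierstrassCurve.Affine.Point.map ι.toRatAlgHom P = heegnerPointComplex Dt H →
      ¬ IsOfFinAddOrder P → Odd (NumberField.discr K) → NumberField.discr K ≠ -3 →
      ¬ (3 : ℤ) ∣ Dt.c →
      (∀ (q : ℕ) [Fact q.Prime], q ∣ N →
        padicValNat 3 ((W.baseChange ℚ_[q]).localTamagawaNumber ℤ_[q]) <
          padicValNat 3 W.tamagawaProduct + padicValNat 3 Dt.c.natAbs) →
      ∀ (s' : ℕ), s' ≤ padicValNat 3 W.tamagawaProduct + padicValNat 3 Dt.c.natAbs →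
        ∀ (n : ℕ) (d : KolyvaginHeegnerData Dt H.β ι n), Squarefree n →
          (∀ ℓ ∈ n.primeFactors, Zhang2014.IsKolyvaginPrime N W K 3 ℓ ∧
            s' ≤ Zhang2014.kolyvaginIndex W 3 ℓ) → Koly.PDiv d 3 s') :
    ∀ (W : WeierstrassCurve ℚ) [W.IsElliptic] [W.IsGloballyMinimal] (N : ℕ) [NeZero N] (K : Type)
      [Field K] [NumberField K] (Dt : ModularParametrizationData W N)
      (H : HeegnerDatum N (NumberField.discr K)) (ι : K →+* ℂ) (P : (W.baseChange K).toAffine.Point),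
      ClassO6 W 3 → W.HasSurjectiveModNGaloisRep 3 → W.analyticRank = 1 → W.conductorNorm ℤ = N →
      IsImaginaryQuadratic K → SatisfiesHeegnerHypothesis N K →
      (W.quadraticTwist (NumberField.discr K : ℚ)).entireLFunction 1 ≠ 0 →
      WeierstrassCurve.Affine.Point.map ι.toRatAlgHom P = heegnerPointComplex Dt H →
      ¬ IsOfFinAddOrder P → Odd (NumberField.discr K) → NumberField.discr K ≠ -3 →
      ¬ (3 : ℤ) ∣ Dt.c →
      ∀ (s' : ℕ), s' ≤ padicValNat 3 W.tamagawaProduct + padicValNat 3 Dt.c.natAbs →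
        ∀ (n : ℕ) (d : KolyvaginHeegnerData Dt H.β ι n), Squarefree n →
          (∀ ℓ ∈ n.primeFactors, Zhang2014.IsKolyvaginPrime N W K 3 ℓ ∧
            s' ≤ Zhang2014.kolyvaginIndex W 3 ℓ) → Koly.PDiv d 3 s' := by
  intro W _ _ N _ K _ _ Dt H ι P hO6 hsurj hr hN hK hHH hLd hP hnt hodd h3 hflat
  by_cases hm : ∀ (q : ℕ) [Fact q.Prime], q ∣ N →
      padicValNat 3 ((W.baseChange ℚ_[q]).localTamagawaNumber ℤ_[q]) <
        padicValNat 3 W.tamagawaProduct + padicValNat 3 Dt.c.natAbs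
  · exact hJmF W N K Dt H ι P hO6 hsurj hr hN hK hHH hLd hP hnt hodd h3 hflat hm
  · push Not at hm
    obtain ⟨q₀, hq₀, hq₀N, hcar⟩ := hm
    intro s' hs' n d hn hℓ
    exact jetchevMaxModThree_of_literature hPT hF1 h372 W N K Dt H ι P hO6 hsurj hr hN hK hHH hLd hP hnt hodd h3
      q₀ hq₀N s' (hs'.trans hcar) n d hn hℓ

/-! ## §3 J′ and Ko′ BY NAME, no tower anywhere -/

/-- **J′ `WildSigmaDivisibilityAtThreeTowerFree` (stmt-24702) BY NAME ⟸ (PT), (F1), (3.7) + ManinScaling₃ + J′♭ on frames with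
≥ 2 Tamagawa `3`-carriers** (§2 ∘ p600275 §1). CONDITIONAL; J′ and BSD stay open. [cite: Jetchev2008, Thm. 1.4, Rem. 1.2 and
Conj. 1.3 (p. 812)] [cite: CesnaviciusNeururerSaha2023, Thm. 1.2] -/
theorem wildSigmaDivisibilityAtThreeTowerFree_of_flatMultiCarrier_of_maninScaling_of_threePrintFacts
    (hPT : ∀ (K : Type) [Field K] [NumberField K], poitouTate_selmerStructure_duality_conj K)
    (hF1 : Gross1991_heegnerPoint_sub_ratTorsion_mem_E0) (h372 : prop37_2_frobeniusCongruence)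
    (hScal : ∀ (W : WeierstrassCurve ℚ) [W.IsElliptic] [W.IsGloballyMinimal] (N : ℕ) [NeZero N],
      ClassO6 W 3 → W.HasSurjectiveModNGaloisRep 3 → W.analyticRank = 1 → W.conductorNorm ℤ = N →
      ∀ (Dt : ModularParametrizationData W N), ∃ (Dt' : ModularParametrizationData W N) (k : ℤ),
        Dt'.f = Dt.f ∧ Dt'.uniformize = Dt.uniformize ∧ Dt.c = k * Dt'.c ∧ ¬ (3 : ℤ) ∣ Dt'.c)
    (hJmF : ∀ (W : WeierstrassCurve ℚ) [W.IsElliptic] [W.IsGloballyMinimal] (N : ℕ) [NeZero N] (K : Type)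
      [Field K] [NumberField K] (Dt : ModularParametrizationData W N)
      (H : HeegnerDatum N (NumberField.discr K)) (ι : K →+* ℂ) (P : (W.baseChange K).toAffine.Point),
      ClassO6 W 3 → W.HasSurjectiveModNGaloisRep 3 → W.analyticRank = 1 → W.conductorNorm ℤ = N →
      IsImaginaryQuadratic K → SatisfiesHeegnerHypothesis N K →
      (W.quadraticTwist (NumberField.discr K : ℚ)).entireLFunction 1 ≠ 0 →
      WeierstrassCurve.Affine.Point.map ι.toRatAlgHom P = heegnerPointComplex Dt H →
      ¬ IsOfFinAddOrder P → Odd (NumberField.discr K) → NumberField.discr K ≠ -3 →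
      ¬ (3 : ℤ) ∣ Dt.c →
      (∀ (q : ℕ) [Fact q.Prime], q ∣ N →
        padicValNat 3 ((W.baseChange ℚ_[q]).localTamagawaNumber ℤ_[q]) <
          padicValNat 3 W.tamagawaProduct + padicValNat 3 Dt.c.natAbs) →
      ∀ (s' : ℕ), s' ≤ padicValNat 3 W.tamagawaProduct + padicValNat 3 Dt.c.natAbs →
        ∀ (n : ℕ) (d : KolyvaginHeegnerData Dt H.β ι n), Squarefree n →
          (∀ ℓ ∈ n.primeFactors, Zhang2014.IsKolyvaginPrime N W K 3 ℓ ∧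
            s' ≤ Zhang2014.kolyvaginIndex W 3 ℓ) → Koly.PDiv d 3 s') :
    WildSigmaDivisibilityAtThreeTowerFree :=
  wildSigmaDivisibilityAtThreeTowerFree_of_flat_of_maninScaling
    (sigmaFlat_of_threePrintFacts_of_flatMultiCarrier hPT hF1 h372 hJmF) hScal

/-- **Crux of record Ko′ `WildKolyvaginUpperAtThreeTowerFree` (stmt-24696) BY NAME ⟸ {CT, 3.7 (2), E0, PT} + ManinScaling₃ +
J′♭ on frames with ≥ 2 TAMAGAWA `3`-carriers — no tower anywhere** (§3 J′ ∘ p594241's tower-free McCallum road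
`WildKolyvaginUpperAtThreeTowerFree.koTowerFree_of_sigmaTowerFree_of_threePrimitives`). The research input of the SOED
Ko′-column is therefore census T17's JET-PRODUCT residue EXACTLY (`hJmF` = Büyükboduk 2009 §4.2 Question 1 at `3`) ⊕ the Manin
scaling statement `hScal` (`3 ∤ c_opt` at `27 ∣ N`); the off-tower exception of p598295/p601995 is gone. CONDITIONAL on the four
named facts, `hScal` and `hJmF`; Ko′, J′, Manin's conjecture and BSD stay open. [cite: McCallumLMS1991, §5 Cor. 5.6 (p. 310)]
[cite: Jetchev2008, Thm. 1.4 and Conj. 1.3 (p. 812)] [cite: Buyukboduk2009TamagawaDefect, §4.2 Question 1]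
[cite: CesnaviciusNeururerSaha2023, Thm. 1.2] [cite: Elkies2006, Introduction] -/
theorem wildKolyvaginUpperAtThreeTowerFree_of_flatMultiCarrier_of_maninScaling_of_fourPrimitives
    (hCT : ∀ (K : Type) [Field K] [NumberField K], casselsTate_levelInputs K)
    (h372 : prop37_2_frobeniusCongruence) (hE0 : Gross1991_heegnerPoint_sub_ratTorsion_mem_E0)
    (hPT : ∀ (K : Type) [Field K] [NumberField K], poitouTate_selmerStructure_duality_conj K)
    (hScal : ∀ (W : WeierstrassCurve ℚ) [W.IsElliptic] [W.IsGloballyMinimal] (N : ℕ) [NeZero N],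
      ClassO6 W 3 → W.HasSurjectiveModNGaloisRep 3 → W.analyticRank = 1 → W.conductorNorm ℤ = N →
      ∀ (Dt : ModularParametrizationData W N), ∃ (Dt' : ModularParametrizationData W N) (k : ℤ),
        Dt'.f = Dt.f ∧ Dt'.uniformize = Dt.uniformize ∧ Dt.c = k * Dt'.c ∧ ¬ (3 : ℤ) ∣ Dt'.c)
    (hJmF : ∀ (W : WeierstrassCurve ℚ) [W.IsElliptic] [W.IsGloballyMinimal] (N : ℕ) [NeZero N] (K : Type)
      [Field K] [NumberField K] (Dt : ModularParametrizationData W N)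
      (H : HeegnerDatum N (NumberField.discr K)) (ι : K →+* ℂ) (P : (W.baseChange K).toAffine.Point),
      ClassO6 W 3 → W.HasSurjectiveModNGaloisRep 3 → W.analyticRank = 1 → W.conductorNorm ℤ = N →
      IsImaginaryQuadratic K → SatisfiesHeegnerHypothesis N K →
      (W.quadraticTwist (NumberField.discr K : ℚ)).entireLFunction 1 ≠ 0 →
      WeierstrassCurve.Affine.Point.map ι.toRatAlgHom P = heegnerPointComplex Dt H →
      ¬ IsOfFinAddOrder P → Odd (NumberField.discr K) → NumberField.discr K ≠ -3 →
      ¬ (3 : ℤ) ∣ Dt.c →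
      (∀ (q : ℕ) [Fact q.Prime], q ∣ N →
        padicValNat 3 ((W.baseChange ℚ_[q]).localTamagawaNumber ℤ_[q]) <
          padicValNat 3 W.tamagawaProduct + padicValNat 3 Dt.c.natAbs) →
      ∀ (s' : ℕ), s' ≤ padicValNat 3 W.tamagawaProduct + padicValNat 3 Dt.c.natAbs →
        ∀ (n : ℕ) (d : KolyvaginHeegnerData Dt H.β ι n), Squarefree n →
          (∀ ℓ ∈ n.primeFactors, Zhang2014.IsKolyvaginPrime N W K 3 ℓ ∧
            s' ≤ Zhang2014.kolyvaginIndex W 3 ℓ) → Koly.PDiv d 3 s') :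
    WildKolyvaginUpperAtThreeTowerFree :=
  WildKolyvaginUpperAtThreeTowerFree.koTowerFree_of_sigmaTowerFree_of_threePrimitives hCT h372 hE0
    (wildSigmaDivisibilityAtThreeTowerFree_of_flatMultiCarrier_of_maninScaling_of_threePrintFacts hPT hE0 h372 hScal hJmF)

/-! ## §4 Without the Manin split: Ko′ BY NAME ⟸ {CT, 3.7 (2), E0, PT} + J′ on MULTI-CARRIER frames (Manin part counted) -/

/-- **J′ BY NAME ⟸ (PT), (F1), (3.7) + J′ on MULTI-CARRIER frames** (`hJm`: J′'s text + «`∀ q ∣ N, ord₃ c_q(E) < ord₃ ∏ c_q +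
v₃ c(Dt)`», the Manin `3`-part counted as a carrier — the pen's `WildSigmaDivisibilityAtThreeMultiCarrier` shape): if one
prime `q₀` carries the whole depth, §1 at `q₀`; otherwise `hJm`. (= p598295 §2's case split with `hJmax` discharged, re-derived
here off the UniversalToricDescent import cone.) CONDITIONAL; J′ and BSD stay open. [cite: Jetchev2008, Thm. 1.4 and Conj. 1.3 (p. 812)] -/
theorem wildSigmaDivisibilityAtThreeTowerFree_of_sigmaMultiCarrier_of_threePrintFacts
    (hPT : ∀ (K : Type) [Field K] [NumberField K], poitouTate_selmerStructure_duality_conj K)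
    (hF1 : Gross1991_heegnerPoint_sub_ratTorsion_mem_E0) (h372 : prop37_2_frobeniusCongruence)
    (hJm : ∀ (W : WeierstrassCurve ℚ) [W.IsElliptic] [W.IsGloballyMinimal] (N : ℕ) [NeZero N] (K : Type)
      [Field K] [NumberField K] (Dt : ModularParametrizationData W N)
      (H : HeegnerDatum N (NumberField.discr K)) (ι : K →+* ℂ) (P : (W.baseChange K).toAffine.Point),
      ClassO6 W 3 → W.HasSurjectiveModNGaloisRep 3 → W.analyticRank = 1 → W.conductorNorm ℤ = N →
      IsImaginaryQuadratic K → SatisfiesHeegnerHypothesis N K →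
      (W.quadraticTwist (NumberField.discr K : ℚ)).entireLFunction 1 ≠ 0 →
      WeierstrassCurve.Affine.Point.map ι.toRatAlgHom P = heegnerPointComplex Dt H →
      ¬ IsOfFinAddOrder P → Odd (NumberField.discr K) → NumberField.discr K ≠ -3 →
      (∀ (q : ℕ) [Fact q.Prime], q ∣ N →
        padicValNat 3 ((W.baseChange ℚ_[q]).localTamagawaNumber ℤ_[q]) <
          padicValNat 3 W.tamagawaProduct + padicValNat 3 Dt.c.natAbs) →
      ∀ (s' : ℕ), s' ≤ padicValNat 3 W.tamagawaProduct + padicValNat 3 Dt.c.natAbs →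
        ∀ (n : ℕ) (d : KolyvaginHeegnerData Dt H.β ι n), Squarefree n →
          (∀ ℓ ∈ n.primeFactors, Zhang2014.IsKolyvaginPrime N W K 3 ℓ ∧
            s' ≤ Zhang2014.kolyvaginIndex W 3 ℓ) → Koly.PDiv d 3 s') :
    WildSigmaDivisibilityAtThreeTowerFree := by
  intro W _ _ N _ K _ _ Dt H ι P hO6 hsurj hr hN hK hHH hLd hP hnt hodd h3
  by_cases hm : ∀ (q : ℕ) [Fact q.Prime], q ∣ N →
      padicValNat 3 ((W.baseChange ℚ_[q]).localTamagawaNumber ℤ_[q]) <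
        padicValNat 3 W.tamagawaProduct + padicValNat 3 Dt.c.natAbs
  · exact hJm W N K Dt H ι P hO6 hsurj hr hN hK hHH hLd hP hnt hodd h3 hm
  · push Not at hm
    obtain ⟨q₀, hq₀, hq₀N, hcar⟩ := hm
    intro s' hs' n d hn hℓ
    exact jetchevMaxModThree_of_literature hPT hF1 h372 W N K Dt H ι P hO6 hsurj hr hN hK hHH hLd hP hnt hodd h3
      q₀ hq₀N s' (hs'.trans hcar) n d hn hℓ

/-- **Ko′ BY NAME ⟸ {CT, 3.7 (2), E0, PT} + J′ on MULTI-CARRIER frames (Manin part counted)** — the pen's act-G shape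
(Ko′ ⟸ primitives ∧ `JetchevMaxDivisibilityAtThreeModThree` ∧ `WildSigmaDivisibilityAtThreeMultiCarrier`) with the Jetchev
item DISCHARGED by §1; no tower anywhere. CONDITIONAL on the four named facts and `hJm` (open research).
[cite: McCallumLMS1991, §5 Cor. 5.6 (p. 310)] [cite: Jetchev2008, Thm. 1.4 and Conj. 1.3 (p. 812)]
[cite: Buyukboduk2009TamagawaDefect, §4.2 Question 1] -/
theorem wildKolyvaginUpperAtThreeTowerFree_of_sigmaMultiCarrier_of_fourPrimitives
    (hCT : ∀ (K : Type) [Field K] [NumberField K], casselsTate_levelInputs K)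
    (h372 : prop37_2_frobeniusCongruence) (hE0 : Gross1991_heegnerPoint_sub_ratTorsion_mem_E0)
    (hPT : ∀ (K : Type) [Field K] [NumberField K], poitouTate_selmerStructure_duality_conj K)
    (hJm : ∀ (W : WeierstrassCurve ℚ) [W.IsElliptic] [W.IsGloballyMinimal] (N : ℕ) [NeZero N] (K : Type)
      [Field K] [NumberField K] (Dt : ModularParametrizationData W N)
      (H : HeegnerDatum N (NumberField.discr K)) (ι : K →+* ℂ) (P : (W.baseChange K).toAffine.Point),
      ClassO6 W 3 → W.HasSurjectiveModNGaloisRep 3 → W.analyticRank = 1 → W.conductorNorm ℤ = N →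
      IsImaginaryQuadratic K → SatisfiesHeegnerHypothesis N K →
      (W.quadraticTwist (NumberField.discr K : ℚ)).entireLFunction 1 ≠ 0 →
      WeierstrassCurve.Affine.Point.map ι.toRatAlgHom P = heegnerPointComplex Dt H →
      ¬ IsOfFinAddOrder P → Odd (NumberField.discr K) → NumberField.discr K ≠ -3 →
      (∀ (q : ℕ) [Fact q.Prime], q ∣ N →
        padicValNat 3 ((W.baseChange ℚ_[q]).localTamagawaNumber ℤ_[q]) <
          padicValNat 3 W.tamagawaProduct + padicValNat 3 Dt.c.natAbs) →
      ∀ (s' : ℕ), s' ≤ padicValNat 3 W.tamagawaProduct + padicValNat 3 Dt.c.natAbs →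
        ∀ (n : ℕ) (d : KolyvaginHeegnerData Dt H.β ι n), Squarefree n →
          (∀ ℓ ∈ n.primeFactors, Zhang2014.IsKolyvaginPrime N W K 3 ℓ ∧
            s' ≤ Zhang2014.kolyvaginIndex W 3 ℓ) → Koly.PDiv d 3 s') :
    WildKolyvaginUpperAtThreeTowerFree :=
  WildKolyvaginUpperAtThreeTowerFree.koTowerFree_of_sigmaTowerFree_of_threePrimitives hCT h372 hE0
    (wildSigmaDivisibilityAtThreeTowerFree_of_sigmaMultiCarrier_of_threePrintFacts hPT hE0 h372 hJm)

end Summit.BirchSwinnertonDyer.BirchSwinnertonDyer.Theorems.WildKolyvaginUpperAtThreeTowerFreeJetchevMaxModThree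

end
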